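import Literature.NumberTheory.Automorphic.UnitaryGroupTorusOrbitalIntegralCanonical   -- ★ (F0P3b-p01 (g7)) S0 FILE 2 `classOrbitalIntegral_eq_smul_integral_prod_of_torus_regular`: the canonical Iwasawa formula
import Mathlib.MeasureTheory.Integral.Prod
import HarnessLib

/-!
# The Selberg principle at a regular split-torus class of `U(H)(L⁺_v)`: orbital integrals of functions whose
# `N`-integrals vanish (supercusp forms) are zero at the hyperbolic regular classes
(Harish-Chandra (1970), Part VIII §1 Lemma 45 «Selberg principle» pp. 92–93, Part I §3 p. 9 (supercusp forms); Rogawski (1990), §4.9 pp. 54–56,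
§12.5 p. 182, §12.6 p. 187 («pseudo-coefficient … if `π` is supercuspidal, `f_π` may be taken to be a matrix coefficient»))

Topic `NumberTheory/Automorphic`; namespace `Literature.NumberTheory.Automorphic.UnitaryGroup`.  KERNEL mathematics only: theorems,
no definition, no named fact, no instance, no notation, no `sorry`.  Cell `pub/hodgecm-mathlib`, crux H413 = `stmt-HodgeConjecture-24833`
(`--supports` lane), CENSUS «HC-SC» v1 (F0P3a-p02 (g26), 686252636736c01a) §2 brick **E2-3b «SELBERG»** — a GENERIC base-layer brick
(LEAD T14-67 standing rule 20): test-function-agnostic, no organ letter, no road implied.  HONEST LABEL: count-neutral; HC_CM is proved only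
modulo the 7 printed citations (2 remaining named inputs: hLiu418 = stmt-HodgeConjecture-24832, h413 = stmt-HodgeConjecture-24833) until rung 0
closes; this file discharges no named fact.

THE MATHEMATICS.  In the frame and binders of ★ `classOrbitalIntegral_eq_smul_integral_prod_of_torus_regular` VERBATIM (`L` CM, `H` hermitian with
invertible determinant, `v` a NON-SPLIT finite place of `L⁺`, `e := cmDatumLocalCongr L v T ha h : U(Φ₃)(L⁺_v) ≃ₜ* U(H)(L⁺_v)`, any Haar `νG`,
a CANONICAL orbital measure family `mG`, the hyperspecial level `K = K₃`, Haar `κ` on `K` and `μ_N` on `N(L⁺_v)`, `t = diag(d) ∈ T(L⁺_v)` REGULAR),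
the ★ Iwasawa formula reads `Φ(⟦e t⟧, φ) = C(t) • ∫_{K × N} φ(e(k (t n) k⁻¹)) d(κ ⊗ μ_N)`.  Hence (§1, Fubini on `K × N`): if
`∫_N φ(e(k (t n) k⁻¹)) dμ_N = 0` for every `k ∈ K`, then **`Φ(⟦e t⟧, φ) = 0`** (`classOrbitalIntegral_torus_eq_zero_of_forall_integral_unipotentU_eq_zero`).
§2 discharges the integrability binders for `φ` CONTINUOUS WITH COMPACT SUPPORT (e.g. locally constant and compactly supported): the integrand on
`K × N` is supported in `K × (N ∩ t⁻¹ K⁻¹ e⁻¹(supp φ) K)`, compact because `N` is closed.  §3 is the form consumers want — the **SELBERG PRINCIPLE**: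
if `φ ∘ e` is a «cusp form» in the sense `∫_N φ(e(a n b)) dμ_N = 0` for all `a, b ∈ U(Φ₃)(L⁺_v)` (whenever the integral converges), then
`Φ(⟦e t⟧, φ) = 0` at every regular `t` (`…_of_cuspidal`), with the matrix-coefficient instance `φ(x) = c · conj ψ(ρ(e⁻¹ x) w)` for a
representation `ρ` of `U(Φ₃)(L⁺_v)` all of whose coefficient `N`-integrals vanish (`…_of_cuspidal_coeff` — the shape of the pseudo-coefficient
`f_π = d(π) ‖v‖⁻² · conj⟨π(·)v, v⟩` of a supercuspidal `π`, [Rogawski1990, §12.6 p. 187]; the vanishing of the coefficient `N`-integrals of a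
supercuspidal representation is Harish-Chandra's «matrix coefficients of supercuspidal representations are supercusp forms», in the tree ★
`integral_dual_apply_unipotentU_eq_zero_of_isSupercuspidal` for the model `U(σ, Φ₃)(K)`), the functional-equation form `φ ∘ e = φ₀` (`…_of_cuspidal'`, so that the IDENTITY frame `H = Φ₃`, `T = 1`
reads `φ₀ := φ`), and the SUPERCUSPIDAL INSTANCE on `U(Φ₃)(L⁺_v) = Gqs L v` itself (no `e`, no `K`∕`κ`∕`μ_N` letters; cusp input ★ p852804, compact support
★ E2-1 A, `N` unimodular) in the companion file `Literature/NumberTheory/Rogawski1990/U3SupercuspidalCoefficientSelberg.lean`.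
What is NOT here: the passage from «`γ` regular non-elliptic» to «`γ` is conjugate to a regular diagonal `t`» (★ `hyperbolicSet` letters of the
datum), and any statement about characters or pseudo-coefficients (census E2-4∕E2-5).

## References
* [HarishChandra1970] Harish-Chandra (notes by G. van Dijk), *Harmonic Analysis on Reductive p-adic Groups*, LNM 162 (1970), Part I §3 p. 9
  (supercusp forms: `Supp f` compact mod `Z` and `f^P = ∫_N f(· n) dn = 0` for all `P ≠ G`; matrix coefficients of supercuspidals), Part VIII §1
  Lemma 45 «Selberg principle» pp. 92–93 (`∫_{G/Γ} θ(γ^x) dx = 0` for `γ ∈ Γ'` unless `Γ` is elliptic; proof: `G = KNM`,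
  `∫_{G/Γ} θ(xγx⁻¹) = ∫_K ∫_{M/Γ} ∫_N θ^k(n m γ m⁻¹ n⁻¹) dn dm dk`).
* [Rogawski1990] J. D. Rogawski, *Automorphic Representations of Unitary Groups in Three Variables*, Ann. of Math. Stud. 123 (1990), §4.9
  pp. 54–56 (orbital integrals at split classes unfold over `K × N`), §12.5 p. 182 (`Φ(γ, f)`), §12.6 p. 187 (pseudo-coefficients of supercuspidals).
-/

set_option autoImplicit false

noncomputable section

open MeasureTheory Measure Set Filter Topology NumberField IsDedekindDomain
open scoped ENNReal NNReal Matrix MatrixGroups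

namespace Literature.NumberTheory.Automorphic.UnitaryGroup

open Literature.NumberTheory.Rogawski1990 (IsRegularElt)
open Literature.NumberTheory.Automorphic

section Frame

/-! ### The binders of ★ `classOrbitalIntegral_eq_smul_integral_prod_of_torus_regular`, verbatim -/

variable (L : Type) [Field L] [NumberField L] [IsCMField L] (H : Matrix (Fin 3) (Fin 3) L)
    (hH : (H.map (IsCMField.complexConj L))ᵀ = H) (hHd : IsUnit H.det)
    {v : HeightOneSpectrum (𝓞 ↥(maximalRealSubfield L))} (w : PlacesOver L v) (hw : IsCMField.complexConj L • w.1 = w.1)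
    (T : GL (Fin 3) (LocalRing L v)) {a : LocalRing L v} (ha : IsUnit a)
    (h : formCongr (conjLocal L (IsCMField.complexConj L) v) T (H.map (algebraMap L (LocalRing L v))) =
      a • (Matrix.of fun i j : Fin 3 => if i.val + j.val + 1 = 3 then (1 : L) else 0).map (algebraMap L (LocalRing L v)))
    [MeasurableSpace ((cmDatum L 3 H).Local v)] [BorelSpace ((cmDatum L 3 H).Local v)]
    [∀ γ : (cmDatum L 3 H).Local v, MeasurableSpace (((cmDatum L 3 H).Local v) ⧸ Subgroup.centralizer ({γ} : Set ((cmDatum L 3 H).Local v)))]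
    [∀ γ : (cmDatum L 3 H).Local v, BorelSpace (((cmDatum L 3 H).Local v) ⧸ Subgroup.centralizer ({γ} : Set ((cmDatum L 3 H).Local v)))]
    (νG : Measure ((cmDatum L 3 H).Local v)) [νG.IsHaarMeasure] [νG.IsMulRightInvariant]
    {mG : OrbitalMeasureFamily ((cmDatum L 3 H).Local v)}
    (hmG : mG.IsCanonical (fun γ => IsRegularElt (γ.val : GL (Fin 3) (LocalRing L v))) νG)
    [MeasurableSpace ↥(unitaryGroupOfForm (conjLocal L (IsCMField.complexConj L) v) (cmLocalForm L 3 v))]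
    [BorelSpace ↥(unitaryGroupOfForm (conjLocal L (IsCMField.complexConj L) v) (cmLocalForm L 3 v))]
    {K : Subgroup ↥(unitaryGroupOfForm (conjLocal L (IsCMField.complexConj L) v) (cmLocalForm L 3 v))}
    (hKv : ∀ g : ↥(unitaryGroupOfForm (conjLocal L (IsCMField.complexConj L) v) (cmLocalForm L 3 v)),
      g ∈ K ↔ g ∈ cmLocalIntegralLevel L 3 (Matrix.of fun i j : Fin 3 => if i.val + j.val + 1 = 3 then (1 : L) else 0) v)
    (κ : Measure ↥K) [κ.IsHaarMeasure]
    (μN : Measure ↥(unipotentU (conjLocal L (IsCMField.complexConj L) v) (cmLocalForm L 3 v))) [μN.IsHaarMeasure]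
    (t : ↥(torusU (conjLocal L (IsCMField.complexConj L) v) (cmLocalForm L 3 v))) {d : Fin 3 → (LocalRing L v)ˣ}
    (hd : glDiagonal 3 (LocalRing L v) d =
      ((t : ↥(unitaryGroupOfForm (conjLocal L (IsCMField.complexConj L) v) (cmLocalForm L 3 v))) : GL (Fin 3) (LocalRing L v)))
    (hreg : ∀ i j, i ≠ j → IsUnit ((d i : LocalRing L v) - d j))
    (ha' : IsUnit ((((d 0)⁻¹ * d 1 : (LocalRing L v)ˣ) : LocalRing L v) - 1))
    (hb' : IsUnit ((((d 0)⁻¹ * d 2 : (LocalRing L v)ˣ) : LocalRing L v) - 1))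

/-! ## §1 FUBINI–SELBERG: vanishing `N`-integrals along `k t · k⁻¹` ⇒ vanishing orbital integral at `⟦e t⟧` -/

include hH hHd hw hmG hKv hd hreg ha' hb' in
/-- **FUBINI–SELBERG at a regular split-torus class.**  In the frame `e : U(Φ₃)(L⁺_v) ≃ₜ* U(H)(L⁺_v)` of ★
`classOrbitalIntegral_eq_smul_integral_prod_of_torus_regular` (non-split `v`, canonical family `mG`, hyperspecial `K`, Haar `κ`, `μ_N`,
regular diagonal `t`): if the `K × N`-integrand `(k, n) ↦ φ(e(k (t n) k⁻¹))` is integrable and for EVERY `k ∈ K` the `N`-integral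
`∫_N φ(e(k (t n) k⁻¹)) dμ_N` vanishes, then the canonical orbital integral of `φ` at `⟦e t⟧` vanishes:
`classOrbitalIntegral mG φ ⟦e t⟧ = 0` (★ Iwasawa formula, then Fubini on `K × N`).
[cite: Rogawski1990, §4.9 pp. 54–56; §12.5 p. 182] [cite: HarishChandra1970, Part VIII §1 Lemma 45 (pp. 92–93)] -/
theorem classOrbitalIntegral_torus_eq_zero_of_forall_integral_unipotentU_eq_zero
    {φ : (cmDatum L 3 H).Local v → ℂ} (hφ : Measurable φ)
    (hint : Integrable (fun p : ↥K × ↥(unipotentU (conjLocal L (IsCMField.complexConj L) v) (cmLocalForm L 3 v)) =>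
      φ (cmDatumLocalCongr L v T ha h
        ((p.1 : ↥(unitaryGroupOfForm (conjLocal L (IsCMField.complexConj L) v) (cmLocalForm L 3 v))) *
          ((t : ↥(unitaryGroupOfForm (conjLocal L (IsCMField.complexConj L) v) (cmLocalForm L 3 v))) *
            (p.2 : ↥(unitaryGroupOfForm (conjLocal L (IsCMField.complexConj L) v) (cmLocalForm L 3 v)))) *
          (p.1 : ↥(unitaryGroupOfForm (conjLocal L (IsCMField.complexConj L) v) (cmLocalForm L 3 v)))⁻¹))) (κ.prod μN))
    (hN : ∀ k : ↥K, ∫ n : ↥(unipotentU (conjLocal L (IsCMField.complexConj L) v) (cmLocalForm L 3 v)),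
      φ (cmDatumLocalCongr L v T ha h
        ((k : ↥(unitaryGroupOfForm (conjLocal L (IsCMField.complexConj L) v) (cmLocalForm L 3 v))) *
          ((t : ↥(unitaryGroupOfForm (conjLocal L (IsCMField.complexConj L) v) (cmLocalForm L 3 v))) *
            (n : ↥(unitaryGroupOfForm (conjLocal L (IsCMField.complexConj L) v) (cmLocalForm L 3 v)))) *
          (k : ↥(unitaryGroupOfForm (conjLocal L (IsCMField.complexConj L) v) (cmLocalForm L 3 v)))⁻¹)) ∂μN = 0) :
    classOrbitalIntegral mG φ
        (ConjClasses.mk (cmDatumLocalCongr L v T ha h (t : ↥(unitaryGroupOfForm (conjLocal L (IsCMField.complexConj L) v) (cmLocalForm L 3 v))))) = 0 := by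
  rw [classOrbitalIntegral_eq_smul_integral_prod_of_torus_regular L H hH hHd w hw T ha h νG hmG hKv κ μN t hd hreg ha' hb' hφ]
  -- `μ_N` is σ-finite: `N(L⁺_v)` is a closed subgroup of the locally compact second countable `U(Φ₃)(L⁺_v)`
  haveI : LocallyCompactSpace ↥(unitaryGroupOfForm (conjLocal L (IsCMField.complexConj L) v) (cmLocalForm L 3 v)) :=
    locallyCompactSpace_local (IsCMField.complexConj L) 3 _ v
  haveI : SecondCountableTopology ↥(unitaryGroupOfForm (conjLocal L (IsCMField.complexConj L) v) (cmLocalForm L 3 v)) :=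
    secondCountableTopology_local (IsCMField.complexConj L) 3 _ v
  haveI : LocallyCompactSpace ↥(unipotentU (conjLocal L (IsCMField.complexConj L) v) (cmLocalForm L 3 v)) :=
    (isClosed_cmBorelTriple_N L v).isClosedEmbedding_subtypeVal.locallyCompactSpace
  haveI : SecondCountableTopology ↥(unipotentU (conjLocal L (IsCMField.complexConj L) v) (cmLocalForm L 3 v)) :=
    TopologicalSpace.Subtype.secondCountableTopology _
  -- `κ` is finite: `K = K₃` is compact
  have hK3 : K = cmLocalIntegralLevel L 3 (Matrix.of fun i j : Fin 3 => if i.val + j.val + 1 = 3 then (1 : L) else 0) v :=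
    Subgroup.ext hKv
  have hKc : IsCompact (K : Set ↥(unitaryGroupOfForm (conjLocal L (IsCMField.complexConj L) v) (cmLocalForm L 3 v))) := by
    rw [hK3]; exact (isCompact_isOpen_cmLocalIntegralLevel L 3 (Matrix.of fun i j : Fin 3 => if i.val + j.val + 1 = 3 then (1 : L) else 0) v).1
  haveI : CompactSpace ↥K := isCompact_iff_compactSpace.mp hKc
  rw [integral_prod _ hint]
  simp only [hN, integral_zero, smul_zero]

/-! ## §2 INTEGRABILITY for continuous compactly supported `φ` (e.g. locally constant with compact support) -/

omit [MeasurableSpace ((cmDatum L 3 H).Local v)] [BorelSpace ((cmDatum L 3 H).Local v)]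
  [∀ γ : (cmDatum L 3 H).Local v, MeasurableSpace (((cmDatum L 3 H).Local v) ⧸ Subgroup.centralizer ({γ} : Set ((cmDatum L 3 H).Local v)))]
  [∀ γ : (cmDatum L 3 H).Local v, BorelSpace (((cmDatum L 3 H).Local v) ⧸ Subgroup.centralizer ({γ} : Set ((cmDatum L 3 H).Local v)))] in
/-- **The `N`-integrand `n ↦ φ(e(a n b))` is integrable** for `φ` continuous with compact support on `U(H)(L⁺_v)`: it is continuous with
compact support on `N(L⁺_v)`, because `n ↦ a n b` followed by the frame `e` is a closed embedding `N(L⁺_v) → U(H)(L⁺_v)` (`N` is closed,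
★ `isClosed_cmBorelTriple_N`), and `μ_N` is finite on compacta. [cite: HarishChandra1970, Part I §3 p. 9] [cite: Rogawski1990, §12.5 p. 182] -/
theorem integrable_unipotentU_conj_of_hasCompactSupport
    {φ : (cmDatum L 3 H).Local v → ℂ} (hφc : Continuous φ) (hφs : HasCompactSupport φ) (a b : ↥(unitaryGroupOfForm (conjLocal L (IsCMField.complexConj L) v) (cmLocalForm L 3 v))) :
    Integrable (fun n : ↥(unipotentU (conjLocal L (IsCMField.complexConj L) v) (cmLocalForm L 3 v)) => φ (cmDatumLocalCongr L v T ha h (a * (n : ↥(unitaryGroupOfForm (conjLocal L (IsCMField.complexConj L) v) (cmLocalForm L 3 v))) * b))) μN := by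
  have hcont : Continuous (fun n : ↥(unipotentU (conjLocal L (IsCMField.complexConj L) v) (cmLocalForm L 3 v)) => φ (cmDatumLocalCongr L v T ha h (a * (n : ↥(unitaryGroupOfForm (conjLocal L (IsCMField.complexConj L) v) (cmLocalForm L 3 v))) * b))) :=
    hφc.comp ((cmDatumLocalCongr L v T ha h).continuous.comp ((continuous_const.mul continuous_subtype_val).mul continuous_const))
  have hemb : IsClosedEmbedding (fun n : ↥(unipotentU (conjLocal L (IsCMField.complexConj L) v) (cmLocalForm L 3 v)) => cmDatumLocalCongr L v T ha h (a * (n : ↥(unitaryGroupOfForm (conjLocal L (IsCMField.complexConj L) v) (cmLocalForm L 3 v))) * b)) :=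
    (cmDatumLocalCongr L v T ha h).toHomeomorph.isClosedEmbedding.comp
      (((Homeomorph.mulRight b).isClosedEmbedding.comp (Homeomorph.mulLeft a).isClosedEmbedding).comp
        (isClosed_cmBorelTriple_N L v).isClosedEmbedding_subtypeVal)
  have hsupp : HasCompactSupport (fun n : ↥(unipotentU (conjLocal L (IsCMField.complexConj L) v) (cmLocalForm L 3 v)) => φ (cmDatumLocalCongr L v T ha h (a * (n : ↥(unitaryGroupOfForm (conjLocal L (IsCMField.complexConj L) v) (cmLocalForm L 3 v))) * b))) :=
    hφs.comp_isClosedEmbedding hemb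
  exact hcont.integrable_of_hasCompactSupport hsupp

omit [MeasurableSpace ((cmDatum L 3 H).Local v)] [BorelSpace ((cmDatum L 3 H).Local v)]
  [∀ γ : (cmDatum L 3 H).Local v, MeasurableSpace (((cmDatum L 3 H).Local v) ⧸ Subgroup.centralizer ({γ} : Set ((cmDatum L 3 H).Local v)))]
  [∀ γ : (cmDatum L 3 H).Local v, BorelSpace (((cmDatum L 3 H).Local v) ⧸ Subgroup.centralizer ({γ} : Set ((cmDatum L 3 H).Local v)))] in
set_option maxHeartbeats 400000 in
include hKv in
/-- **The `K × N`-integrand `(k, n) ↦ φ(e(k (t n) k⁻¹))` of the ★ Iwasawa formula is integrable** for `φ` continuous with compact support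
on `U(H)(L⁺_v)`: it is continuous, and supported in the compact set `K × (N ∩ t⁻¹ · {k⁻¹ c k : k ∈ K, c ∈ e⁻¹(supp φ)})` (`K = K₃` compact,
★ `isCompact_isOpen_cmLocalIntegralLevel`; `N` closed, ★ `isClosed_cmBorelTriple_N`); `κ ⊗ μ_N` is finite on compacta.
[cite: Rogawski1990, §4.9 pp. 54–56] [cite: HarishChandra1970, Part VIII §1 Lemma 45 (pp. 92–93)] -/
theorem integrable_prod_unipotentU_conj_of_hasCompactSupport
    {φ : (cmDatum L 3 H).Local v → ℂ} (hφc : Continuous φ) (hφs : HasCompactSupport φ) :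
    Integrable (fun p : ↥K × ↥(unipotentU (conjLocal L (IsCMField.complexConj L) v) (cmLocalForm L 3 v)) =>
      φ (cmDatumLocalCongr L v T ha h ((p.1 : ↥(unitaryGroupOfForm (conjLocal L (IsCMField.complexConj L) v) (cmLocalForm L 3 v))) * ((t : ↥(unitaryGroupOfForm (conjLocal L (IsCMField.complexConj L) v) (cmLocalForm L 3 v))) * (p.2 : ↥(unitaryGroupOfForm (conjLocal L (IsCMField.complexConj L) v) (cmLocalForm L 3 v)))) * (p.1 : ↥(unitaryGroupOfForm (conjLocal L (IsCMField.complexConj L) v) (cmLocalForm L 3 v)))⁻¹))) (κ.prod μN) := by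
  haveI : LocallyCompactSpace ↥(unitaryGroupOfForm (conjLocal L (IsCMField.complexConj L) v) (cmLocalForm L 3 v)) := locallyCompactSpace_local (IsCMField.complexConj L) 3 _ v
  haveI : SecondCountableTopology ↥(unitaryGroupOfForm (conjLocal L (IsCMField.complexConj L) v) (cmLocalForm L 3 v)) := secondCountableTopology_local (IsCMField.complexConj L) 3 _ v
  have hK3 : K = cmLocalIntegralLevel L 3 (Matrix.of fun i j : Fin 3 => if i.val + j.val + 1 = 3 then (1 : L) else 0) v :=
    Subgroup.ext hKv
  have hKc : IsCompact (K : Set ↥(unitaryGroupOfForm (conjLocal L (IsCMField.complexConj L) v) (cmLocalForm L 3 v))) := by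
    rw [hK3]; exact (isCompact_isOpen_cmLocalIntegralLevel L 3 (Matrix.of fun i j : Fin 3 => if i.val + j.val + 1 = 3 then (1 : L) else 0) v).1
  haveI : CompactSpace ↥K := isCompact_iff_compactSpace.mp hKc
  have hcont : Continuous (fun p : ↥K × ↥(unipotentU (conjLocal L (IsCMField.complexConj L) v) (cmLocalForm L 3 v)) =>
      φ (cmDatumLocalCongr L v T ha h ((p.1 : ↥(unitaryGroupOfForm (conjLocal L (IsCMField.complexConj L) v) (cmLocalForm L 3 v))) * ((t : ↥(unitaryGroupOfForm (conjLocal L (IsCMField.complexConj L) v) (cmLocalForm L 3 v))) * (p.2 : ↥(unitaryGroupOfForm (conjLocal L (IsCMField.complexConj L) v) (cmLocalForm L 3 v)))) * (p.1 : ↥(unitaryGroupOfForm (conjLocal L (IsCMField.complexConj L) v) (cmLocalForm L 3 v)))⁻¹))) :=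
    hφc.comp ((cmDatumLocalCongr L v T ha h).continuous.comp
      (((continuous_subtype_val.comp continuous_fst).mul
        (continuous_const.mul (continuous_subtype_val.comp continuous_snd))).mul
        (continuous_subtype_val.comp continuous_fst).inv))
  -- the compact set carrying the support: `K × (N ∩ t⁻¹ K⁻¹ C K)`, `C` the support of `φ ∘ e`
  have hCc : HasCompactSupport (fun u : ↥(unitaryGroupOfForm (conjLocal L (IsCMField.complexConj L) v) (cmLocalForm L 3 v)) => φ (cmDatumLocalCongr L v T ha h u)) :=
    hφs.comp_isClosedEmbedding (cmDatumLocalCongr L v T ha h).toHomeomorph.isClosedEmbedding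
  have hDc : IsCompact ((fun q : ↥(unitaryGroupOfForm (conjLocal L (IsCMField.complexConj L) v) (cmLocalForm L 3 v)) × ↥(unitaryGroupOfForm (conjLocal L (IsCMField.complexConj L) v) (cmLocalForm L 3 v)) => (t : ↥(unitaryGroupOfForm (conjLocal L (IsCMField.complexConj L) v) (cmLocalForm L 3 v)))⁻¹ * ((q.1)⁻¹ * q.2 * q.1)) ''
      ((K : Set ↥(unitaryGroupOfForm (conjLocal L (IsCMField.complexConj L) v) (cmLocalForm L 3 v))) ×ˢ tsupport (fun u : ↥(unitaryGroupOfForm (conjLocal L (IsCMField.complexConj L) v) (cmLocalForm L 3 v)) => φ (cmDatumLocalCongr L v T ha h u)))) :=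
    (hKc.prod hCc).image (continuous_const.mul ((continuous_fst.inv.mul continuous_snd).mul continuous_fst))
  have hS : IsCompact ((Set.univ : Set ↥K) ×ˢ
      (Subtype.val ⁻¹' ((fun q : ↥(unitaryGroupOfForm (conjLocal L (IsCMField.complexConj L) v) (cmLocalForm L 3 v)) × ↥(unitaryGroupOfForm (conjLocal L (IsCMField.complexConj L) v) (cmLocalForm L 3 v)) => (t : ↥(unitaryGroupOfForm (conjLocal L (IsCMField.complexConj L) v) (cmLocalForm L 3 v)))⁻¹ * ((q.1)⁻¹ * q.2 * q.1)) ''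
        ((K : Set ↥(unitaryGroupOfForm (conjLocal L (IsCMField.complexConj L) v) (cmLocalForm L 3 v))) ×ˢ tsupport (fun u : ↥(unitaryGroupOfForm (conjLocal L (IsCMField.complexConj L) v) (cmLocalForm L 3 v)) => φ (cmDatumLocalCongr L v T ha h u)))) : Set ↥(unipotentU (conjLocal L (IsCMField.complexConj L) v) (cmLocalForm L 3 v)))) :=
    isCompact_univ.prod ((isClosed_cmBorelTriple_N L v).isClosedEmbedding_subtypeVal.isCompact_preimage hDc)
  have hsupp : HasCompactSupport (fun p : ↥K × ↥(unipotentU (conjLocal L (IsCMField.complexConj L) v) (cmLocalForm L 3 v)) =>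
      φ (cmDatumLocalCongr L v T ha h ((p.1 : ↥(unitaryGroupOfForm (conjLocal L (IsCMField.complexConj L) v) (cmLocalForm L 3 v))) * ((t : ↥(unitaryGroupOfForm (conjLocal L (IsCMField.complexConj L) v) (cmLocalForm L 3 v))) * (p.2 : ↥(unitaryGroupOfForm (conjLocal L (IsCMField.complexConj L) v) (cmLocalForm L 3 v)))) * (p.1 : ↥(unitaryGroupOfForm (conjLocal L (IsCMField.complexConj L) v) (cmLocalForm L 3 v)))⁻¹))) := by
    refine HasCompactSupport.intro hS fun p hp => ?_
    by_contra hne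
    have hmem : ((p.1 : ↥(unitaryGroupOfForm (conjLocal L (IsCMField.complexConj L) v) (cmLocalForm L 3 v))) * ((t : ↥(unitaryGroupOfForm (conjLocal L (IsCMField.complexConj L) v) (cmLocalForm L 3 v))) * (p.2 : ↥(unitaryGroupOfForm (conjLocal L (IsCMField.complexConj L) v) (cmLocalForm L 3 v)))) * (p.1 : ↥(unitaryGroupOfForm (conjLocal L (IsCMField.complexConj L) v) (cmLocalForm L 3 v)))⁻¹) ∈ tsupport (fun u : ↥(unitaryGroupOfForm (conjLocal L (IsCMField.complexConj L) v) (cmLocalForm L 3 v)) => φ (cmDatumLocalCongr L v T ha h u)) :=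
      subset_tsupport (fun u : ↥(unitaryGroupOfForm (conjLocal L (IsCMField.complexConj L) v) (cmLocalForm L 3 v)) => φ (cmDatumLocalCongr L v T ha h u)) hne
    refine hp (Set.mem_prod.mpr ⟨Set.mem_univ _, ?_⟩)
    refine ⟨((p.1 : ↥(unitaryGroupOfForm (conjLocal L (IsCMField.complexConj L) v) (cmLocalForm L 3 v))), ((p.1 : ↥(unitaryGroupOfForm (conjLocal L (IsCMField.complexConj L) v) (cmLocalForm L 3 v))) * ((t : ↥(unitaryGroupOfForm (conjLocal L (IsCMField.complexConj L) v) (cmLocalForm L 3 v))) * (p.2 : ↥(unitaryGroupOfForm (conjLocal L (IsCMField.complexConj L) v) (cmLocalForm L 3 v)))) * (p.1 : ↥(unitaryGroupOfForm (conjLocal L (IsCMField.complexConj L) v) (cmLocalForm L 3 v)))⁻¹)), Set.mem_prod.mpr ⟨p.1.2, hmem⟩, ?_⟩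
    dsimp only
    group
  exact hcont.integrable_of_hasCompactSupport hsupp

/-! ## §3 THE SELBERG PRINCIPLE: cusp forms (vanishing `N`-integrals) have vanishing orbital integrals at the regular split classes -/

include hH hHd hw hmG hKv hd hreg ha' hb' in
/-- **SELBERG PRINCIPLE at a regular split-torus class of `U(H)(L⁺_v)`.**  Same frame as ★
`classOrbitalIntegral_eq_smul_integral_prod_of_torus_regular`.  Let `φ : U(H)(L⁺_v) → ℂ` be continuous with compact support (e.g. locally
constant, compactly supported) and a CUSP FORM along the frame: `∫_N φ(e(a n b)) dμ_N = 0` for all `a, b ∈ U(Φ₃)(L⁺_v)` (whenever the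
integrand is integrable — it always is, `integrable_unipotentU_conj_of_hasCompactSupport`).  Then the canonical orbital integral of `φ` at the
class of `e t` vanishes for every REGULAR diagonal `t`: `classOrbitalIntegral mG φ ⟦e t⟧ = 0` — Harish-Chandra's «Selberg principle» (orbital
integrals of supercusp forms vanish off the elliptic set) at the hyperbolic regular classes, via the Iwasawa unfolding `Φ(⟦e t⟧, φ) =
C(t) • ∫_K ∫_N φ(e(k t n k⁻¹))` with `(a, b) = (k t, k⁻¹)`. [cite: HarishChandra1970, Part VIII §1 Lemma 45 (pp. 92–93); Part I §3 p. 9]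
[cite: Rogawski1990, §4.9 pp. 54–56; §12.6 p. 187] -/
theorem classOrbitalIntegral_torus_eq_zero_of_cuspidal
    {φ : (cmDatum L 3 H).Local v → ℂ} (hφc : Continuous φ) (hφs : HasCompactSupport φ)
    (hcusp : ∀ a b : ↥(unitaryGroupOfForm (conjLocal L (IsCMField.complexConj L) v) (cmLocalForm L 3 v)), Integrable (fun n : ↥(unipotentU (conjLocal L (IsCMField.complexConj L) v) (cmLocalForm L 3 v)) => φ (cmDatumLocalCongr L v T ha h (a * (n : ↥(unitaryGroupOfForm (conjLocal L (IsCMField.complexConj L) v) (cmLocalForm L 3 v))) * b))) μN →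
      ∫ n : ↥(unipotentU (conjLocal L (IsCMField.complexConj L) v) (cmLocalForm L 3 v)), φ (cmDatumLocalCongr L v T ha h (a * (n : ↥(unitaryGroupOfForm (conjLocal L (IsCMField.complexConj L) v) (cmLocalForm L 3 v))) * b)) ∂μN = 0) :
    classOrbitalIntegral mG φ (ConjClasses.mk (cmDatumLocalCongr L v T ha h (t : ↥(unitaryGroupOfForm (conjLocal L (IsCMField.complexConj L) v) (cmLocalForm L 3 v))))) = 0 := by
  -- a Haar measure `κ` on the compact open `K = K₃` (the constant of the Iwasawa formula is irrelevant here)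
  haveI : LocallyCompactSpace ↥(unitaryGroupOfForm (conjLocal L (IsCMField.complexConj L) v) (cmLocalForm L 3 v)) := locallyCompactSpace_local (IsCMField.complexConj L) 3 _ v
  have hK3 : K = cmLocalIntegralLevel L 3 (Matrix.of fun i j : Fin 3 => if i.val + j.val + 1 = 3 then (1 : L) else 0) v :=
    Subgroup.ext hKv
  have hKc : IsCompact (K : Set ↥(unitaryGroupOfForm (conjLocal L (IsCMField.complexConj L) v) (cmLocalForm L 3 v))) := by
    rw [hK3]; exact (isCompact_isOpen_cmLocalIntegralLevel L 3 (Matrix.of fun i j : Fin 3 => if i.val + j.val + 1 = 3 then (1 : L) else 0) v).1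
  haveI : CompactSpace ↥K := isCompact_iff_compactSpace.mp hKc
  haveI : LocallyCompactSpace ↥K := hKc.isClosed.isClosedEmbedding_subtypeVal.locallyCompactSpace
  exact classOrbitalIntegral_torus_eq_zero_of_forall_integral_unipotentU_eq_zero L H hH hHd w hw T ha h νG hmG hKv Measure.haar μN t hd
    hreg ha' hb' hφc.measurable (integrable_prod_unipotentU_conj_of_hasCompactSupport L H T ha h hKv Measure.haar μN t hφc hφs) fun k => by
      have h0 := hcusp ((k : ↥(unitaryGroupOfForm (conjLocal L (IsCMField.complexConj L) v) (cmLocalForm L 3 v))) * (t : ↥(unitaryGroupOfForm (conjLocal L (IsCMField.complexConj L) v) (cmLocalForm L 3 v)))) (k : ↥(unitaryGroupOfForm (conjLocal L (IsCMField.complexConj L) v) (cmLocalForm L 3 v)))⁻¹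
        (integrable_unipotentU_conj_of_hasCompactSupport L H T ha h μN hφc hφs ((k : ↥(unitaryGroupOfForm (conjLocal L (IsCMField.complexConj L) v) (cmLocalForm L 3 v))) * (t : ↥(unitaryGroupOfForm (conjLocal L (IsCMField.complexConj L) v) (cmLocalForm L 3 v)))) (k : ↥(unitaryGroupOfForm (conjLocal L (IsCMField.complexConj L) v) (cmLocalForm L 3 v)))⁻¹)
      simpa only [mul_assoc] using h0

include hH hHd hw hmG hKv hd hreg ha' hb' in
/-- **SELBERG PRINCIPLE, functional-equation form** (`φ ∘ e = φ₀`): the same with the test function given on `U(H)(L⁺_v)` as `φ` and on `U(Φ₃)(L⁺_v)` as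
`φ₀`, related by `φ (e u) = φ₀ u` — so that at `H = Φ₃` with the IDENTITY frame (`T = 1`, `e u = u`) one takes `φ₀ := φ`; hypotheses on `φ₀`:
continuous, compactly supported, and a cusp form `∫_N φ₀(a n b) dμ_N = 0`. [cite: HarishChandra1970, Part VIII §1 Lemma 45 (pp. 92–93)]
[cite: Rogawski1990, §4.9 pp. 54–56] -/
theorem classOrbitalIntegral_torus_eq_zero_of_cuspidal'
    {φ : (cmDatum L 3 H).Local v → ℂ} {φ₀ : ↥(unitaryGroupOfForm (conjLocal L (IsCMField.complexConj L) v) (cmLocalForm L 3 v)) → ℂ} (hφ : ∀ u : ↥(unitaryGroupOfForm (conjLocal L (IsCMField.complexConj L) v) (cmLocalForm L 3 v)), φ (cmDatumLocalCongr L v T ha h u) = φ₀ u)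
    (h0c : Continuous φ₀) (h0s : HasCompactSupport φ₀)
    (hcusp : ∀ a b : ↥(unitaryGroupOfForm (conjLocal L (IsCMField.complexConj L) v) (cmLocalForm L 3 v)), Integrable (fun n : ↥(unipotentU (conjLocal L (IsCMField.complexConj L) v) (cmLocalForm L 3 v)) => φ₀ (a * (n : ↥(unitaryGroupOfForm (conjLocal L (IsCMField.complexConj L) v) (cmLocalForm L 3 v))) * b)) μN →
      ∫ n : ↥(unipotentU (conjLocal L (IsCMField.complexConj L) v) (cmLocalForm L 3 v)), φ₀ (a * (n : ↥(unitaryGroupOfForm (conjLocal L (IsCMField.complexConj L) v) (cmLocalForm L 3 v))) * b) ∂μN = 0) :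
    classOrbitalIntegral mG φ (ConjClasses.mk (cmDatumLocalCongr L v T ha h (t : ↥(unitaryGroupOfForm (conjLocal L (IsCMField.complexConj L) v) (cmLocalForm L 3 v))))) = 0 := by
  obtain rfl : φ = fun x => φ₀ ((cmDatumLocalCongr L v T ha h).symm x) :=
    funext fun x => by simpa only [ContinuousMulEquiv.apply_symm_apply] using hφ ((cmDatumLocalCongr L v T ha h).symm x)
  refine classOrbitalIntegral_torus_eq_zero_of_cuspidal L H hH hHd w hw T ha h νG hmG hKv μN t hd hreg ha' hb'
    (h0c.comp (cmDatumLocalCongr L v T ha h).symm.continuous) (h0s.comp_isClosedEmbedding (cmDatumLocalCongr L v T ha h).symm.toHomeomorph.isClosedEmbedding) fun a b hi => ?_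
  simp only [ContinuousMulEquiv.symm_apply_apply] at hi ⊢
  exact hcusp a b hi

include hH hHd hw hmG hKv hd hreg ha' hb' in
/-- **SELBERG PRINCIPLE for cuspidal matrix coefficients** (the pseudo-coefficient shape).  Same frame.  Let `ρ` be a representation of
`U(Φ₃)(L⁺_v)` on `V`, `ψ` a linear form, `y ∈ V`, `c ∈ ℂ`, such that the coefficient `x ↦ ψ(ρ(x) y)` is continuous with compact support
(e.g. `ρ` smooth supercuspidal, compact centre) and all its `N`-integrals vanish: `∫_N ψ(ρ(a n b) y) dμ_N = 0` for all `a, b` (whenever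
integrable — the conclusion of ★ `integral_dual_apply_unipotentU_eq_zero_of_isSupercuspidal` for supercuspidal `ρ`, «matrix coefficients of
supercuspidals are supercusp forms»).  Then any `φ` on `U(H)(L⁺_v)` with `φ(e u) = c · conj ψ(ρ(u) y)` (binder `hφ`; i.e. `φ = c · conj ψ(ρ(e⁻¹ ·) y)`) — the shape of the pseudo-coefficient
`f_π = d(π)‖v‖⁻² · conj⟨π(·)v, v⟩` of a supercuspidal `π` — has `classOrbitalIntegral mG φ ⟦e t⟧ = 0` at every regular diagonal `t`.
[cite: Rogawski1990, §12.6 p. 187; §4.9 pp. 54–56] [cite: HarishChandra1970, Part VIII §1 Lemma 45 (pp. 92–93); Part I §3 p. 9] -/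
theorem classOrbitalIntegral_torus_eq_zero_of_cuspidal_coeff
    {V : Type*} [AddCommGroup V] [Module ℂ V] (ρ : Representation ℂ ↥(unitaryGroupOfForm (conjLocal L (IsCMField.complexConj L) v) (cmLocalForm L 3 v)) V) (ψ : Module.Dual ℂ V) (y : V) (c : ℂ)
    (hcont : Continuous fun x : ↥(unitaryGroupOfForm (conjLocal L (IsCMField.complexConj L) v) (cmLocalForm L 3 v)) => ψ (ρ x y)) (hsupp : HasCompactSupport fun x : ↥(unitaryGroupOfForm (conjLocal L (IsCMField.complexConj L) v) (cmLocalForm L 3 v)) => ψ (ρ x y))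
    (hcoef : ∀ a b : ↥(unitaryGroupOfForm (conjLocal L (IsCMField.complexConj L) v) (cmLocalForm L 3 v)), Integrable (fun n : ↥(unipotentU (conjLocal L (IsCMField.complexConj L) v) (cmLocalForm L 3 v)) => ψ (ρ (a * (n : ↥(unitaryGroupOfForm (conjLocal L (IsCMField.complexConj L) v) (cmLocalForm L 3 v))) * b) y)) μN →
      ∫ n : ↥(unipotentU (conjLocal L (IsCMField.complexConj L) v) (cmLocalForm L 3 v)), ψ (ρ (a * (n : ↥(unitaryGroupOfForm (conjLocal L (IsCMField.complexConj L) v) (cmLocalForm L 3 v))) * b) y) ∂μN = 0)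
    {φ : (cmDatum L 3 H).Local v → ℂ} (hφ : ∀ u : ↥(unitaryGroupOfForm (conjLocal L (IsCMField.complexConj L) v) (cmLocalForm L 3 v)), φ (cmDatumLocalCongr L v T ha h u) = c * starRingEnd ℂ (ψ (ρ u y))) :
    classOrbitalIntegral mG φ (ConjClasses.mk (cmDatumLocalCongr L v T ha h (t : ↥(unitaryGroupOfForm (conjLocal L (IsCMField.complexConj L) v) (cmLocalForm L 3 v))))) = 0 := by
  -- `φ = c · conj ψ(ρ(e⁻¹ ·) y)`
  obtain rfl : φ = fun x => c * starRingEnd ℂ (ψ (ρ ((cmDatumLocalCongr L v T ha h).symm x) y)) :=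
    funext fun x => by simpa only [ContinuousMulEquiv.apply_symm_apply] using hφ ((cmDatumLocalCongr L v T ha h).symm x)
  have hφ1c : Continuous (fun x : (cmDatum L 3 H).Local v => ψ (ρ ((cmDatumLocalCongr L v T ha h).symm x) y)) :=
    hcont.comp (cmDatumLocalCongr L v T ha h).symm.continuous
  have hφ1s : HasCompactSupport (fun x : (cmDatum L 3 H).Local v => ψ (ρ ((cmDatumLocalCongr L v T ha h).symm x) y)) :=
    hsupp.comp_isClosedEmbedding (cmDatumLocalCongr L v T ha h).symm.toHomeomorph.isClosedEmbedding
  have hφc : Continuous (fun x : (cmDatum L 3 H).Local v => c * starRingEnd ℂ (ψ (ρ ((cmDatumLocalCongr L v T ha h).symm x) y))) :=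
    continuous_const.mul (Complex.continuous_conj.comp hφ1c)
  have hφs : HasCompactSupport (fun x : (cmDatum L 3 H).Local v => c * starRingEnd ℂ (ψ (ρ ((cmDatumLocalCongr L v T ha h).symm x) y))) :=
    hφ1s.comp_left (g := fun z : ℂ => c * starRingEnd ℂ z) (by simp only [map_zero, mul_zero])
  haveI : LocallyCompactSpace ↥(unitaryGroupOfForm (conjLocal L (IsCMField.complexConj L) v) (cmLocalForm L 3 v)) := locallyCompactSpace_local (IsCMField.complexConj L) 3 _ v
  have hK3 : K = cmLocalIntegralLevel L 3 (Matrix.of fun i j : Fin 3 => if i.val + j.val + 1 = 3 then (1 : L) else 0) v :=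
    Subgroup.ext hKv
  have hKc : IsCompact (K : Set ↥(unitaryGroupOfForm (conjLocal L (IsCMField.complexConj L) v) (cmLocalForm L 3 v))) := by
    rw [hK3]; exact (isCompact_isOpen_cmLocalIntegralLevel L 3 (Matrix.of fun i j : Fin 3 => if i.val + j.val + 1 = 3 then (1 : L) else 0) v).1
  haveI : CompactSpace ↥K := isCompact_iff_compactSpace.mp hKc
  haveI : LocallyCompactSpace ↥K := hKc.isClosed.isClosedEmbedding_subtypeVal.locallyCompactSpace
  refine classOrbitalIntegral_torus_eq_zero_of_forall_integral_unipotentU_eq_zero L H hH hHd w hw T ha h νG hmG hKv Measure.haar μN t hd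
    hreg ha' hb' hφc.measurable (integrable_prod_unipotentU_conj_of_hasCompactSupport L H T ha h hKv Measure.haar μN t hφc hφs) fun k => ?_
  have hi : Integrable (fun n : ↥(unipotentU (conjLocal L (IsCMField.complexConj L) v) (cmLocalForm L 3 v)) => ψ (ρ ((k : ↥(unitaryGroupOfForm (conjLocal L (IsCMField.complexConj L) v) (cmLocalForm L 3 v))) * (t : ↥(unitaryGroupOfForm (conjLocal L (IsCMField.complexConj L) v) (cmLocalForm L 3 v))) * (n : ↥(unitaryGroupOfForm (conjLocal L (IsCMField.complexConj L) v) (cmLocalForm L 3 v))) * (k : ↥(unitaryGroupOfForm (conjLocal L (IsCMField.complexConj L) v) (cmLocalForm L 3 v)))⁻¹) y)) μN := by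
    have := integrable_unipotentU_conj_of_hasCompactSupport L H T ha h μN hφ1c hφ1s ((k : ↥(unitaryGroupOfForm (conjLocal L (IsCMField.complexConj L) v) (cmLocalForm L 3 v))) * (t : ↥(unitaryGroupOfForm (conjLocal L (IsCMField.complexConj L) v) (cmLocalForm L 3 v)))) (k : ↥(unitaryGroupOfForm (conjLocal L (IsCMField.complexConj L) v) (cmLocalForm L 3 v)))⁻¹
    simpa only [ContinuousMulEquiv.symm_apply_apply] using this
  have h0 : ∫ n : ↥(unipotentU (conjLocal L (IsCMField.complexConj L) v) (cmLocalForm L 3 v)), ψ (ρ ((k : ↥(unitaryGroupOfForm (conjLocal L (IsCMField.complexConj L) v) (cmLocalForm L 3 v))) * ((t : ↥(unitaryGroupOfForm (conjLocal L (IsCMField.complexConj L) v) (cmLocalForm L 3 v))) * (n : ↥(unitaryGroupOfForm (conjLocal L (IsCMField.complexConj L) v) (cmLocalForm L 3 v)))) * (k : ↥(unitaryGroupOfForm (conjLocal L (IsCMField.complexConj L) v) (cmLocalForm L 3 v)))⁻¹) y) ∂μN = 0 := by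
    simpa only [mul_assoc] using hcoef ((k : ↥(unitaryGroupOfForm (conjLocal L (IsCMField.complexConj L) v) (cmLocalForm L 3 v))) * (t : ↥(unitaryGroupOfForm (conjLocal L (IsCMField.complexConj L) v) (cmLocalForm L 3 v)))) (k : ↥(unitaryGroupOfForm (conjLocal L (IsCMField.complexConj L) v) (cmLocalForm L 3 v)))⁻¹ hi
  simp only [ContinuousMulEquiv.symm_apply_apply]
  rw [integral_const_mul, integral_conj, h0, map_zero, mul_zero]

end Frame

end Literature.NumberTheory.Automorphic.UnitaryGroup

end
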